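import Literature.Analysis.FluidPDE.TurbWave0

/-!
# Route MomentParity · `GalerkinEnsembleRealization` — from Birkhoff averages over integer windows
  to the long-time means `timeMean` / `longTimeAvgSup`

Elementary Cesàro bookkeeping for the realisation step (stmt-AnomalousDissipation-11466): for a
nonnegative locally integrable `g : ℝ → ℝ`,
* convergence of the means over the integer windows `[0, n]` implies convergence of
  `timeMean g T = T⁻¹ ∫₀ᵀ g` as `T → ∞` (sandwich between `⌊T⌋` and `⌊T⌋ + 1`);
* the limit of `timeMean` is unchanged under a time shift `g(s + ·)`;
* `longTimeAvgSup g` (a `limsup`) is that limit, and a comparison principle giving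
  `ℓ ≤ longTimeAvgSup h` whenever `timeMean g ≤ timeMean h ≤ B` eventually and `timeMean g → ℓ`.
-/

noncomputable section

open MeasureTheory Set Filter Topology Function

namespace Summit.AnomalousDissipation.AnomalousDissipation.Theorems.MomentParity

set_option linter.dupNamespace false

open Literature.Analysis.FluidPDE

/-- Monotonicity of the primitive of a nonnegative locally integrable function. -/
theorem intervalIntegral_mono_right {g : ℝ → ℝ} (hg : ∀ t, 0 ≤ g t)
    (hgi : ∀ a b : ℝ, IntervalIntegrable g volume a b) {b b' : ℝ} (hb : 0 ≤ b) (hbb' : b ≤ b') :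
    ∫ t in (0 : ℝ)..b, g t ≤ ∫ t in (0 : ℝ)..b', g t :=
  intervalIntegral.integral_mono_interval le_rfl hb hbb' (ae_of_all _ fun t => hg t) (hgi 0 b')

/-- **From integer windows to all windows**: if `n⁻¹ ∫₀ⁿ g → ℓ` along `n ∈ ℕ` for a nonnegative
locally integrable `g`, then `timeMean g T → ℓ` as `T → ∞`. -/
theorem tendsto_timeMean_of_nat {g : ℝ → ℝ} (hg : ∀ t, 0 ≤ g t)
    (hgi : ∀ a b : ℝ, IntervalIntegrable g volume a b) {ℓ : ℝ}
    (h : Tendsto (fun n : ℕ => (n : ℝ)⁻¹ * ∫ t in (0 : ℝ)..n, g t) atTop (𝓝 ℓ)) :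
    Tendsto (timeMean g) atTop (𝓝 ℓ) := by
  -- lower and upper sandwich functions
  have hfloor : Tendsto (fun T : ℝ => ⌊T⌋₊) atTop atTop := tendsto_nat_floor_atTop
  have hratio : Tendsto (fun T : ℝ => (⌊T⌋₊ : ℝ) / T) atTop (𝓝 1) := tendsto_nat_floor_div_atTop
  have hratio' : Tendsto (fun T : ℝ => ((⌊T⌋₊ : ℝ) + 1) / T) atTop (𝓝 1) := by
    have h1 : Tendsto (fun T : ℝ => T⁻¹) atTop (𝓝 0) := tendsto_inv_atTop_zero
    have := hratio.add h1
    simp only [add_zero] at this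
    refine this.congr' ?_
    filter_upwards [eventually_gt_atTop 0] with T hT
    field_simp
  have hlow : Tendsto (fun T : ℝ => (⌊T⌋₊ : ℝ) / T * ((⌊T⌋₊ : ℝ)⁻¹ * ∫ t in (0 : ℝ)..(⌊T⌋₊ : ℕ), g t))
      atTop (𝓝 ℓ) := by
    have := hratio.mul (h.comp hfloor)
    rw [one_mul] at this
    exact this
  have hup : Tendsto (fun T : ℝ => ((⌊T⌋₊ : ℝ) + 1) / T *
      (((⌊T⌋₊ + 1 : ℕ) : ℝ)⁻¹ * ∫ t in (0 : ℝ)..((⌊T⌋₊ + 1 : ℕ) : ℝ), g t)) atTop (𝓝 ℓ) := by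
    have h2 : Tendsto (fun T : ℝ => ⌊T⌋₊ + 1) atTop atTop := tendsto_add_atTop_nat 1 |>.comp hfloor
    have := hratio'.mul (h.comp h2)
    rw [one_mul] at this
    refine this.congr' (Eventually.of_forall fun T => ?_)
    simp only [comp_apply]
  refine tendsto_of_tendsto_of_tendsto_of_le_of_le' hlow hup ?_ ?_
  · filter_upwards [eventually_ge_atTop 1] with T hT
    have hT0 : 0 < T := by linarith
    have hn : (1 : ℝ) ≤ ⌊T⌋₊ := by exact_mod_cast Nat.le_floor (by simpa using hT)
    have hnT : (⌊T⌋₊ : ℝ) ≤ T := Nat.floor_le hT0.le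
    rw [timeMean]
    have hI := intervalIntegral_mono_right hg hgi (by positivity) hnT
    calc (⌊T⌋₊ : ℝ) / T * ((⌊T⌋₊ : ℝ)⁻¹ * ∫ t in (0 : ℝ)..(⌊T⌋₊ : ℕ), g t)
        = T⁻¹ * ∫ t in (0 : ℝ)..(⌊T⌋₊ : ℕ), g t := by field_simp
      _ ≤ T⁻¹ * ∫ t in (0 : ℝ)..T, g t := mul_le_mul_of_nonneg_left hI (inv_nonneg.2 hT0.le)
  · filter_upwards [eventually_ge_atTop 1] with T hT
    have hT0 : 0 < T := by linarith
    have hnT : T ≤ ((⌊T⌋₊ + 1 : ℕ) : ℝ) := by push_cast; exact (Nat.lt_floor_add_one T).le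
    rw [timeMean]
    have hI := intervalIntegral_mono_right hg hgi hT0.le hnT
    have hpos : (0 : ℝ) < (⌊T⌋₊ : ℝ) + 1 := by positivity
    calc T⁻¹ * ∫ t in (0 : ℝ)..T, g t ≤ T⁻¹ * ∫ t in (0 : ℝ)..((⌊T⌋₊ + 1 : ℕ) : ℝ), g t :=
          mul_le_mul_of_nonneg_left hI (inv_nonneg.2 hT0.le)
      _ = ((⌊T⌋₊ : ℝ) + 1) / T * (((⌊T⌋₊ + 1 : ℕ) : ℝ)⁻¹ * ∫ t in (0 : ℝ)..((⌊T⌋₊ + 1 : ℕ) : ℝ), g t) := by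
          push_cast; field_simp

/-- **Time shifts do not change the long-time mean**: if `timeMean g T → ℓ` for a locally
integrable `g` then `timeMean (g (s + ·)) T → ℓ` for every `s ≥ 0`. -/
theorem tendsto_timeMean_comp_add {g : ℝ → ℝ} (hgi : ∀ a b : ℝ, IntervalIntegrable g volume a b)
    {ℓ : ℝ} (h : Tendsto (timeMean g) atTop (𝓝 ℓ)) {s : ℝ} (hs : 0 ≤ s) :
    Tendsto (timeMean fun t => g (s + t)) atTop (𝓝 ℓ) := by
  -- `∫₀ᵀ g(s+t) dt = ∫₀^{s+T} g - ∫₀^s g` for `T > 0`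
  have heq : ∀ T, 0 < T → timeMean (fun t => g (s + t)) T =
      (s + T) / T * timeMean g (s + T) - T⁻¹ * ∫ t in (0 : ℝ)..s, g t := by
    intro T hT
    rw [timeMean, timeMean, intervalIntegral.integral_comp_add_left (fun t => g t) s, add_zero,
      ← intervalIntegral.integral_add_adjacent_intervals (hgi 0 s) (hgi s (s + T))]
    have hsT : s + T ≠ 0 := by linarith
    field_simp
    ring
  have hsT : Tendsto (fun T : ℝ => s + T) atTop atTop := tendsto_atTop_add_const_left _ _ tendsto_id
  have h1 : Tendsto (fun T : ℝ => (s + T) / T) atTop (𝓝 1) := by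
    have : Tendsto (fun T : ℝ => s * T⁻¹ + 1) atTop (𝓝 (s * 0 + 1)) :=
      (tendsto_inv_atTop_zero.const_mul s).add_const 1
    rw [mul_zero, zero_add] at this
    refine this.congr' ?_
    filter_upwards [eventually_gt_atTop 0] with T hT
    field_simp
  have h2 : Tendsto (fun T : ℝ => T⁻¹ * ∫ t in (0 : ℝ)..s, g t) atTop (𝓝 0) := by
    have := tendsto_inv_atTop_zero.mul_const (∫ t in (0 : ℝ)..s, g t)
    rwa [zero_mul] at this
  have := (h1.mul (h.comp hsT)).sub h2
  rw [one_mul, sub_zero] at this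
  refine this.congr' ?_
  filter_upwards [eventually_gt_atTop 0] with T hT
  rw [heq T hT]
  rfl

/-- The long-time mean `longTimeAvgSup g` of a function whose running means converge is the
limit. -/
theorem longTimeAvgSup_eq_of_tendsto {g : ℝ → ℝ} {ℓ : ℝ} (h : Tendsto (timeMean g) atTop (𝓝 ℓ)) :
    longTimeAvgSup g = ℓ :=
  h.limsup_eq

/-- **Comparison principle for `longTimeAvgSup`**: if eventually `timeMean g T ≤ timeMean h T ≤ B`
and `timeMean g T → ℓ`, then `ℓ ≤ longTimeAvgSup h`. -/
theorem le_longTimeAvgSup_of_tendsto {g h : ℝ → ℝ} {ℓ B : ℝ}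
    (hg : Tendsto (timeMean g) atTop (𝓝 ℓ)) (hgh : ∀ᶠ T in atTop, timeMean g T ≤ timeMean h T)
    (hB : ∀ᶠ T in atTop, timeMean h T ≤ B) : ℓ ≤ longTimeAvgSup h := by
  rw [longTimeAvgSup]
  have hbdd : IsBoundedUnder (· ≤ ·) atTop (timeMean h) := isBoundedUnder_of_eventually_le hB
  have hbdd' : IsBoundedUnder (· ≥ ·) atTop (timeMean h) := by
    refine isBoundedUnder_of_eventually_ge (a := ℓ - 1) ?_
    filter_upwards [hgh, hg.eventually (eventually_gt_nhds (by linarith : ℓ - 1 < ℓ))] with T h1 h2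
    exact h2.le.trans h1
  calc ℓ = liminf (timeMean g) atTop := hg.liminf_eq.symm
    _ ≤ liminf (timeMean h) atTop :=
        liminf_le_liminf hgh hg.isBoundedUnder_ge hbdd.isCoboundedUnder_ge
    _ ≤ limsup (timeMean h) atTop := liminf_le_limsup hbdd hbdd'

/-- The long-time mean of a function whose running means are eventually bounded by `B` is at
most `B`. -/
theorem longTimeAvgSup_le_of_eventually_le {h : ℝ → ℝ} {B b : ℝ}
    (hB : ∀ᶠ T in atTop, timeMean h T ≤ B) (hb : ∀ᶠ T in atTop, b ≤ timeMean h T) :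
    longTimeAvgSup h ≤ B := by
  rw [longTimeAvgSup]
  exact limsup_le_of_le (isBoundedUnder_of_eventually_ge hb).isCoboundedUnder_le hB

end Summit.AnomalousDissipation.AnomalousDissipation.Theorems.MomentParity
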